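import Summits.MatrixMultiplication.MatrixMultiplication.Theorems.ObstructionDescentOddLevelFormatTwo

set_option linter.dupNamespace false

/-!
# Obstruction descent, part O — the levels of format 2: `emptyLevels 2 2 = {k | k odd}`

`route-MatrixMultiplication-ObstructionDescent`, aside `InvariantSaturation` (stmt 32282); decomp-mm lens-3, NODE-g15.

Part N proved that every ODD level is empty at format `2`.  This file proves the converse — every EVEN level carries a
weight vector — so that the format-`2` column of the invariant tower is decided completely
(`mem_emptyLevels_two_two_iff`, `mem_emptyLevels_two_iff`): `k ∈ emptyLevels m 2 ↔ k` odd, for every `m ≥ 2`.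

The even vectors are the powers of CAYLEY'S HYPERDETERMINANT
`Δ = x₀₀₀²x₁₁₁² + x₀₀₁²x₁₁₀² + x₀₁₀²x₁₀₁² + x₀₁₁²x₁₀₀² − 2(x₀₀₀x₀₀₁x₁₁₀x₁₁₁ + x₀₀₀x₀₁₀x₁₀₁x₁₁₁ + x₀₀₀x₀₁₁x₁₀₀x₁₁₁
 + x₀₀₁x₀₁₀x₁₀₁x₁₁₀ + x₀₀₁x₀₁₁x₁₁₀x₁₀₀ + x₀₁₀x₀₁₁x₁₀₁x₁₀₀) + 4(x₀₀₀x₀₁₁x₁₀₁x₁₁₀ + x₀₀₁x₀₁₀x₁₀₀x₁₁₁)`,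
a `B₂³`-semi-invariant quartic of weight `((2,2),(2,2),(2,2))` (`exists_level_two_vector_two`: the semi-invariance
under upper-triangular triples is one polynomial identity, checked by `ring`; `Δ(e₀₀₀ + e₁₁₁) = 1`).  Products of
weight vectors are weight vectors (`mul_mem_hwvSpace`), so `Δ^j` is a non-zero vector of level `2j`.

[cite: BurgisserIkenmeyer2011, §3.1–3.2], [cite: BurgisserIkenmeyer2017, §5 (5.2)], [cite: LandsbergGCT2017, §8.3.4].
-/

noncomputable section

open scoped BigOperators
open Finset

namespace Summit.MatrixMultiplication.MatrixMultiplication.Theorems.ObstructionCalculus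

open Literature.Computability.AlgebraicComplexity (actTensor actTensor_apply)

section FormatTwoLevels

/-- Powers of a weight vector are weight vectors (of the multiplied type and degree). [bookkeeping] -/
theorem pow_mem_hwvSpace {m : ℕ} {Λ : Fin 3 → Fin m → ℕ} {d : ℕ} {f : MvPolynomial (Idx m) ℂ}
    (hf : f ∈ hwvSpace Λ d) : ∀ j : ℕ, f ^ j ∈ hwvSpace (j • Λ) (j * d)
  | 0 => by
    rw [pow_zero, zero_smul, zero_mul]
    exact one_mem_hwvSpace_zero
  | j + 1 => by
    rw [pow_succ, succ_nsmul, Nat.succ_mul]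
    exact mul_mem_hwvSpace (pow_mem_hwvSpace hf j) hf

/-- `j • ((k^N))³ = (((jk)^N))³`. [bookkeeping] -/
theorem nsmul_rectType {m : ℕ} (N k j : ℕ) : j • rectType m N k = rectType m N (j * k) := by
  funext s i
  simp only [Pi.smul_apply, smul_eq_mul, rectType]
  split_ifs <;> simp

/-- **Cayley's hyperdeterminant is a level-2 vector at format 2:** there is a non-zero weight vector of type
`((2,2),(2,2),(2,2))`, degree `4`, on `ℂ²⊗ℂ²⊗ℂ²`. [this node] -/
theorem exists_level_two_vector_two :
    ∃ Δ : MvPolynomial (Idx 2) ℂ, Δ ≠ 0 ∧ Δ ∈ hwvSpace (rectType 2 2 2) (2 * 2) := by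
  classical
  let X : Fin 2 → Fin 2 → Fin 2 → MvPolynomial (Idx 2) ℂ := fun a b c => MvPolynomial.X (a, b, c)
  refine ⟨X 0 0 0 ^ 2 * X 1 1 1 ^ 2 + X 0 0 1 ^ 2 * X 1 1 0 ^ 2 + X 0 1 0 ^ 2 * X 1 0 1 ^ 2 + X 0 1 1 ^ 2 * X 1 0 0 ^ 2
    - 2 * (X 0 0 0 * X 0 0 1 * X 1 1 0 * X 1 1 1 + X 0 0 0 * X 0 1 0 * X 1 0 1 * X 1 1 1
      + X 0 0 0 * X 0 1 1 * X 1 0 0 * X 1 1 1 + X 0 0 1 * X 0 1 0 * X 1 0 1 * X 1 1 0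
      + X 0 0 1 * X 0 1 1 * X 1 1 0 * X 1 0 0 + X 0 1 0 * X 0 1 1 * X 1 0 1 * X 1 0 0)
    + 4 * (X 0 0 0 * X 0 1 1 * X 1 0 1 * X 1 1 0 + X 0 0 1 * X 0 1 0 * X 1 0 0 * X 1 1 1), ?_, ?_, ?_⟩
  · -- `Δ(e₀₀₀ + e₁₁₁) = 1`
    intro h
    have h1 := congrArg (evalT fun a b c => ![![![(1 : ℂ), 0], ![0, 0]], ![![0, 0], ![0, 1]]] a b c) h
    simp [X, evalT, map_add, map_sub, map_mul, map_pow, MvPolynomial.aeval_X] at h1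
  · -- homogeneity of degree 4
    refine isHomogeneous_of_eval_smul_ne_zero _ (2 * 2) fun s _ y => ?_
    simp only [X, map_add, map_sub, map_mul, map_pow, map_ofNat, MvPolynomial.eval_X, Pi.smul_apply, smul_eq_mul]
    ring
  · -- semi-invariance under upper-triangular triples
    intro A B C hA hB hC t
    have hA0 : A 1 0 = 0 := hA.1 1 0 (by decide)
    have hB0 : B 1 0 = 0 := hB.1 1 0 (by decide)
    have hC0 : C 1 0 = 0 := hC.1 1 0 (by decide)
    simp only [X, evalT, map_add, map_sub, map_mul, map_pow, map_ofNat, MvPolynomial.aeval_X, weightChar,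
      Fin.prod_univ_two, rectType_self_apply, actTensor_apply, Fin.sum_univ_two, hA0, hB0, hC0]
    ring

/-- **Even levels pass at format 2:** `k ∉ emptyLevels 2 2` for `k` even (`Δ^{k/2} ≠ 0`). [this node] -/
theorem not_mem_emptyLevels_two_two_of_even {k : ℕ} (hk : Even k) : k ∉ emptyLevels 2 2 := by
  obtain ⟨j, rfl⟩ := hk
  obtain ⟨Δ, hΔ0, hΔ⟩ := exists_level_two_vector_two
  intro h
  have hbot : hwvSpace (rectType 2 2 (j + j)) ((j + j) * 2) = ⊥ := h
  have hpow := pow_mem_hwvSpace hΔ j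
  rw [nsmul_rectType, show j * 2 = j + j by ring, show j * (2 * 2) = (j + j) * 2 by ring, hbot,
    Submodule.mem_bot] at hpow
  exact pow_ne_zero j hΔ0 hpow

/-- **The levels of format 2:** `k ∈ emptyLevels 2 2 ↔ k` is odd. [this node] -/
theorem mem_emptyLevels_two_two_iff {k : ℕ} : k ∈ emptyLevels 2 2 ↔ Odd k :=
  ⟨fun h => by
    rcases Nat.even_or_odd k with he | ho
    · exact absurd h (not_mem_emptyLevels_two_two_of_even he)
    · exact ho, mem_emptyLevels_two_two_of_odd⟩

/-- **The format-2 column of the invariant tower at every ambient format `m ≥ 2`:** `k ∈ emptyLevels m 2 ↔ k` is odd.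
[this node] -/
theorem mem_emptyLevels_two_iff {m k : ℕ} (hm : 2 ≤ m) : k ∈ emptyLevels m 2 ↔ Odd k := by
  rw [mem_emptyLevels_iff_self hm]
  exact mem_emptyLevels_two_two_iff

end FormatTwoLevels

end Summit.MatrixMultiplication.MatrixMultiplication.Theorems.ObstructionCalculus

end
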